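import Summits.QuantumFields.BalabanUV.T4Continuum.Support.VariationalVectorBochner
import Summits.QuantumFields.BalabanUV.T4Continuum.Support.VariationalColourDirichletForm
import Summits.QuantumFields.BalabanUV.T4Continuum.Support.VariationalVectorGarding

/-!
# T⁴ programme, spine node NE2 (U1a), lane P2 — SUPPLIER ITEM «V-REG FEYNMAN, GENERAL `E`», file 1∕3: THE SESQUILINEAR FEYNMAN FORM OF E-VALUED
# 1-FORMS `½⟨curl V, curl W⟩ + ⟨div V, div W⟩`, ITS EULER–LAGRANGE OPERATOR `½curl†curl + D div`, AND THE FIRST VARIATION AT A CONSTRAINED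
# MINIMISER on a fibre of the line-indexed average `QvL T` — function world, `E` any finite-dimensional Hilbert space (the colour 1-form carriers)
# (the 1-form re-run of `VariationalColourDirichletForm`; the general-`E` FEYNMAN-INHABITANT COMPLEMENT of leaf-03-g5's «V-REG PROPER» matrix-world
# chain `VariationalGradientDuality` ∕ `VariationalVectorRegularity` ∕ `…Rho` (`E = ℂ`, general gauge matrix `Gm`), filed at their request, CLAIMS.log l.15496)

NE2 formalisation swarm `b2b-balaban-t4-ne2-formalise-*`, leaf prover 02 (gen 5); register P2-sup (V-REG PROPER on 1-forms is leaf-03-g5's item, INTENT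
CLAIMS.log l.15022; this complement: my OFFER l.15432, their answer (iii) l.15496 — delineation: THEIRS = matrix world at `E = ℂ`, general `Gm` with a
(REG-G) binder; OURS = function world at general `E`, the Feynman inhabitant `landauG 1` only; same multiplier-free mechanism, the two meet at `E = ℂ`).  Carriers BY NAME: the road's `VariationalVectorForm.{curlV, curlSq, ScV}` (p216339),
`VariationalVectorWeitzenbock.{divV, divSq}` (p218860), `VariationalVectorBochner.{curlAdjCurlV, gradDivV, sum_ipv_curlAdjCurlV, sum_ipv_gradDivV}`
(p219745), `VectorBlockTrialForm.{nsqV, QvL}`, `VariationalVectorGarding.landauG` (p219068), leaf-09-g4's `VariationalColourBochner.{ipv, Dirv, DirAdjv}`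
and this seat's `VariationalColourDirichletForm.{ipv_add_left, …}`.
 * §1 the pairing of 1-forms `ipvV V W := Σ_ν ipv (V·ν) (W·ν)` (`ipvV_self = nsqV`), the FEYNMAN EULER–LAGRANGE OPERATOR
   `elV R W := ½curl†curl W + D div W` (`curlAdjCurlV + gradDivV` — EXACTLY the operator of leaf-09-g6's vector Bochner `sum_hessv_le_el`), the
   sesquilinear Feynman form `bformV R V W := ½Σ_{μ,ν} ipv (curl_{μν}V) (curl_{μν}W) + ipv (div V) (div W)` with `ipvV V (elV W) = bformV V W`
   (`ipvV_elV`, from p219745's two first-variation identities), Hermitian symmetry, (sesqui)linearity, diagonal `bformV W W = curlSq∕2 + divSq`;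
 * §2 FIRST VARIATION: `QvL T` is ℂ-linear (`QvL_add_smul`); `F(W + t•H) = F W + 2t·Re bformV H W + t²·F H` for `F := curlSq∕2 + divSq`
   (`feyn_add_smul`); the Feynman inhabitant of the road's vector form is `ScV n M R (landauG 1 R) W = n^{−d}·(n²·F W)` (`ScV_landau_one`); hence at a
   minimiser of `ScV R (landauG 1 R)` on the affine fibre `{W₂ : QvL T W₂ = φ}`: `bformV H W = 0` and `ipvV H (elV W) = 0` for every `H ∈ ker QvL T`
   (`bformV_eq_zero_of_isMin`, `ipvV_elV_eq_zero_of_isMin`).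
Files 2∕3 (`VariationalVectorFeynmanRegularity`: `Σ‖elV W‖² ≤ Λ∕n^d·F W` at the minimiser by UB⁺-duality, NO multiplier structure needed — the
competitor for the datum `QvL T (elV W)` is subtracted; leaf-03-g5's `VariationalGradientDuality.nsq_mulVec_le_of_isMin` is the matrix-world statement of the
same lemma) and 3∕3 (`VariationalVectorFeynmanRegularityRho`: physical units + vector Bochner ⟹ the `hREG` binder of `vector_pair_bracket_sqrt` ∕ leaf-10-g3's
general-`E` END for `ρ := rhoV`, `G := landauG 1`).

HONEST FRAMING (T4-DAG p. 1).  Model level: bond operators `R` and line transports `T` are DATA; the gauge functional is the FEYNMAN INHABITANT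
`landauG 1 R = divSq R` of the road's DATA slot `G` (decision (D2)); whether the END's `G` is this one is V-GF's question (OPEN; N-ne2leaf01g6-1,
leaf-09-g6's located remark on (GF2)) — nothing here decides it.  Elementary, [folklore]; nothing printed is a hypothesis; no `def … : Prop`; no
`sorry`; axioms standard.  NE2 NOT proved; spine PROVED 0∕9; rung (B)+1 finite T⁴ — NOT infinite volume, NOT a mass gap, NOT Clay.  HONEST DEPENDENCY
(cell, verbatim): continuum YM on T⁴ ⇐ BetaPertH ∧ nine spine estimates (0/9 proved); BetaPertH ⇐ (D1) ∧ (D4) ∧ CAP+tail; G-an2-4 gates asym, D1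
and NE2/3/4.
-/

noncomputable section

namespace Summit.QuantumFields.BalabanUV.T4Continuum.VariationalVectorFeynmanForm

open Finset
open scoped InnerProductSpace ComplexConjugate
open Literature.MathematicalPhysics.QuantumFieldTheory.Balaban1983to89.B5Prop11Plancherel (Tor fine unitVec)
open Literature.MathematicalPhysics.QuantumFieldTheory.Balaban1983to89.B5Block118 (bpt tstep)
open Summit.QuantumFields.BalabanUV.T4Continuum.VariationalColourBochner (nsqv Dirv DirAdjv ipv ipv_self conj_ipv)
open Summit.QuantumFields.BalabanUV.T4Continuum.VariationalColourDirichletForm (ipv_add_left ipv_add_right ipv_smul_left ipv_smul_right)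
open Summit.QuantumFields.BalabanUV.T4Continuum.VectorBlockTrialForm (nsqV nsqV_nonneg QvL)
open Summit.QuantumFields.BalabanUV.T4Continuum.VariationalVectorForm (cdV curlV curlSq curlSq_nonneg ScV)
open Summit.QuantumFields.BalabanUV.T4Continuum.VariationalVectorWeitzenbock (divV divSq divSq_nonneg nsqV_eq_sum_nsqv)
open Summit.QuantumFields.BalabanUV.T4Continuum.VariationalVectorBochner (curlAdjCurlV gradDivV sum_ipv_curlAdjCurlV sum_ipv_gradDivV)
open Summit.QuantumFields.BalabanUV.T4Continuum.VariationalVectorGarding (landauG)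

variable {d : ℕ} {E : Type*} [NormedAddCommGroup E] [InnerProductSpace ℂ E] [CompleteSpace E]

/-! ## §1 The pairing of 1-forms, the Feynman Euler–Lagrange operator, the sesquilinear Feynman form -/

section General

variable (N : Fin d → ℕ) [∀ μ, NeZero (N μ)]

/-- the `ℓ²` pairing of `E`-valued 1-forms: `Σ_ν Σ_x ⟪V(x,ν), W(x,ν)⟫`. [folklore] -/
def ipvV (V W : Tor N → Fin d → E) : ℂ := ∑ ν, ipv N (fun y => V y ν) (fun y => W y ν)

omit [CompleteSpace E] in
/-- `ipvV W W = nsqV W`. [folklore] -/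
theorem ipvV_self (W : Tor N → Fin d → E) : ipvV N W W = ((nsqV N W : ℝ) : ℂ) := by
  unfold ipvV
  rw [nsqV_eq_sum_nsqv]
  push_cast
  refine sum_congr rfl fun ν _ => ?_
  rw [ipv_self]
  unfold VariationalColourBochner.nsqv
  push_cast
  rfl

omit [CompleteSpace E] in
/-- Hermitian symmetry of the pairing. [folklore] -/
theorem conj_ipvV (V W : Tor N → Fin d → E) : conj (ipvV N V W) = ipvV N W V := by
  unfold ipvV; rw [map_sum]; exact sum_congr rfl fun ν _ => conj_ipv N _ _

omit [CompleteSpace E] in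
/-- the pairing of a difference (first slot). [folklore] -/
theorem ipvV_sub_left (V₁ V₂ W : Tor N → Fin d → E) : ipvV N (V₁ - V₂) W = ipvV N V₁ W - ipvV N V₂ W := by
  unfold ipvV
  rw [← sum_sub_distrib]
  refine sum_congr rfl fun ν _ => ?_
  rw [← VariationalColourDirichletForm.ipv_sub_left]
  rfl

omit [CompleteSpace E] in
/-- `‖ipvV V W‖ ≤ Σ_{ν,x} ‖V(x,ν)‖·‖W(x,ν)‖`. [folklore] -/
theorem norm_ipvV_le (V W : Tor N → Fin d → E) : ‖ipvV N V W‖ ≤ ∑ ν, ∑ x, ‖V x ν‖ * ‖W x ν‖ := by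
  unfold ipvV
  exact (norm_sum_le _ _).trans (sum_le_sum fun ν _ => VariationalColourBochner.norm_ipv_le N _ _)

/-- **THE FEYNMAN EULER–LAGRANGE OPERATOR** `(elV R W)(x,ν) = (½curl†curl W)_ν(x) + (D_ν div W)(x)` — the operator of leaf-09-g6's vector Bochner
estimate `VariationalVectorBochner.sum_hessv_le_el`. [folklore] -/
def elV (R : Tor N → Fin d → (E →L[ℂ] E)) (W : Tor N → Fin d → E) (x : Tor N) (ν : Fin d) : E :=
  curlAdjCurlV N R W x ν + gradDivV N R W x ν

/-- **THE SESQUILINEAR FEYNMAN FORM** `½Σ_{μ,ν} ⟨curl_{μν}V, curl_{μν}W⟩_{ℓ²} + ⟨div V, div W⟩_{ℓ²}`. [folklore] -/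
def bformV (R : Tor N → Fin d → (E →L[ℂ] E)) (V W : Tor N → Fin d → E) : ℂ :=
  (1 / 2 : ℂ) * ∑ μ, ∑ ν, ipv N (fun y => curlV N R V y μ ν) (fun y => curlV N R W y μ ν) + ipv N (divV N R V) (divV N R W)

/-- **FIRST-VARIATION IDENTITY**: `Σ_ν ⟨V_ν, (elV W)_ν⟩_{ℓ²} = bformV V W` (leaf-09-g6's `sum_ipv_curlAdjCurlV` + `sum_ipv_gradDivV`). [folklore] -/
theorem ipvV_elV (R : Tor N → Fin d → (E →L[ℂ] E)) (V W : Tor N → Fin d → E) :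
    ipvV N V (fun x ν => elV N R W x ν) = bformV N R V W := by
  unfold ipvV bformV
  have h : ∀ ν, ipv N (fun y => V y ν) (fun y => elV N R W y ν)
      = ipv N (fun y => V y ν) (fun x => curlAdjCurlV N R W x ν) + ipv N (fun y => V y ν) (fun x => gradDivV N R W x ν) := by
    intro ν
    rw [← ipv_add_right]
    rfl
  simp_rw [h]
  rw [sum_add_distrib, sum_ipv_curlAdjCurlV, sum_ipv_gradDivV]

/-- the diagonal of the Feynman form: `bformV W W = curlSq W ∕ 2 + divSq W`. [folklore] -/
theorem bformV_self (R : Tor N → Fin d → (E →L[ℂ] E)) (W : Tor N → Fin d → E) :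
    bformV N R W W = ((curlSq N R W / 2 + divSq N R W : ℝ) : ℂ) := by
  unfold bformV
  have hc : ∑ μ, ∑ ν, ipv N (fun y => curlV N R W y μ ν) (fun y => curlV N R W y μ ν) = ((curlSq N R W : ℝ) : ℂ) := by
    have hreal : curlSq N R W = ∑ μ, ∑ ν, nsqv N (fun y => curlV N R W y μ ν) := by
      unfold curlSq
      rw [Finset.sum_comm]
      refine sum_congr rfl fun μ _ => ?_
      rw [Finset.sum_comm]
      rfl
    rw [hreal]; push_cast
    exact sum_congr rfl fun μ _ => sum_congr rfl fun ν _ => ipv_self N _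
  have hd : ipv N (divV N R W) (divV N R W) = ((divSq N R W : ℝ) : ℂ) := by
    rw [ipv_self]; rfl
  rw [hc, hd]; push_cast; ring

/-- Hermitian symmetry of the Feynman form. [folklore] -/
theorem conj_bformV (R : Tor N → Fin d → (E →L[ℂ] E)) (V W : Tor N → Fin d → E) : conj (bformV N R V W) = bformV N R W V := by
  unfold bformV
  rw [map_add, map_mul, map_sum, conj_ipv]
  congr 1
  rw [show conj (1 / 2 : ℂ) = 1 / 2 by rw [map_div₀, map_one, map_ofNat]]
  congr 1
  refine sum_congr rfl fun μ _ => ?_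
  rw [map_sum]
  exact sum_congr rfl fun ν _ => conj_ipv N _ _

omit [∀ μ, NeZero (N μ)] [CompleteSpace E] in
/-- the curl is additive in the 1-form (as a field, fixed directions). [folklore] -/
theorem curlV_field_add (R : Tor N → Fin d → (E →L[ℂ] E)) (V W : Tor N → Fin d → E) (μ ν : Fin d) :
    (fun y => curlV N R (V + W) y μ ν) = (fun y => curlV N R V y μ ν) + fun y => curlV N R W y μ ν := by
  funext y
  simp only [curlV, cdV, Pi.add_apply, map_add]
  abel

omit [∀ μ, NeZero (N μ)] [CompleteSpace E] in
/-- the curl is homogeneous in the 1-form. [folklore] -/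
theorem curlV_field_smul (R : Tor N → Fin d → (E →L[ℂ] E)) (c : ℂ) (W : Tor N → Fin d → E) (μ ν : Fin d) :
    (fun y => curlV N R (c • W) y μ ν) = c • fun y => curlV N R W y μ ν := by
  funext y
  simp only [curlV, cdV, Pi.smul_apply, map_smul, smul_sub]

omit [∀ μ, NeZero (N μ)] in
/-- the divergence is additive in the 1-form. [folklore] -/
theorem divV_add (R : Tor N → Fin d → (E →L[ℂ] E)) (V W : Tor N → Fin d → E) : divV N R (V + W) = divV N R V + divV N R W := by
  funext x
  simp only [divV, DirAdjv, Pi.add_apply, map_add]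
  rw [← sum_add_distrib]
  exact sum_congr rfl fun μ _ => by abel

omit [∀ μ, NeZero (N μ)] in
/-- the divergence is homogeneous in the 1-form. [folklore] -/
theorem divV_smul (R : Tor N → Fin d → (E →L[ℂ] E)) (c : ℂ) (W : Tor N → Fin d → E) : divV N R (c • W) = c • divV N R W := by
  funext x
  simp only [divV, DirAdjv, Pi.smul_apply, map_smul, smul_sub, Finset.smul_sum]

/-- additivity of the Feynman form in the first slot. [folklore] -/
theorem bformV_add_left (R : Tor N → Fin d → (E →L[ℂ] E)) (V₁ V₂ W : Tor N → Fin d → E) :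
    bformV N R (V₁ + V₂) W = bformV N R V₁ W + bformV N R V₂ W := by
  simp only [bformV, curlV_field_add, divV_add, ipv_add_left, sum_add_distrib]
  ring

/-- additivity of the Feynman form in the second slot. [folklore] -/
theorem bformV_add_right (R : Tor N → Fin d → (E →L[ℂ] E)) (V W₁ W₂ : Tor N → Fin d → E) :
    bformV N R V (W₁ + W₂) = bformV N R V W₁ + bformV N R V W₂ := by
  simp only [bformV, curlV_field_add, divV_add, ipv_add_right, sum_add_distrib]
  ring

/-- conjugate-homogeneity of the Feynman form in the first slot. [folklore] -/
theorem bformV_smul_left (R : Tor N → Fin d → (E →L[ℂ] E)) (c : ℂ) (V W : Tor N → Fin d → E) :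
    bformV N R (c • V) W = conj c * bformV N R V W := by
  simp only [bformV, curlV_field_smul, divV_smul, ipv_smul_left, ← mul_sum]
  ring

/-- homogeneity of the Feynman form in the second slot. [folklore] -/
theorem bformV_smul_right (R : Tor N → Fin d → (E →L[ℂ] E)) (c : ℂ) (V W : Tor N → Fin d → E) :
    bformV N R V (c • W) = c * bformV N R V W := by
  simp only [bformV, curlV_field_smul, divV_smul, ipv_smul_right, ← mul_sum]
  ring

/-- expansion of the Feynman action `F := curlSq∕2 + divSq` along a real line: `F(W + t•H) = F W + 2t·Re bformV H W + t²·F H`. [folklore] -/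
theorem feyn_add_smul (R : Tor N → Fin d → (E →L[ℂ] E)) (W H : Tor N → Fin d → E) (t : ℝ) :
    curlSq N R (W + (t : ℂ) • H) / 2 + divSq N R (W + (t : ℂ) • H)
      = (curlSq N R W / 2 + divSq N R W) + 2 * t * (bformV N R H W).re + t ^ 2 * (curlSq N R H / 2 + divSq N R H) := by
  set w : ℂ := bformV N R H W with hw
  have hfh : bformV N R W H = conj w := by rw [hw, conj_bformV]
  have e : ((curlSq N R (W + (t : ℂ) • H) / 2 + divSq N R (W + (t : ℂ) • H) : ℝ) : ℂ)
      = ((curlSq N R W / 2 + divSq N R W : ℝ) : ℂ) + (t : ℂ) * conj w + (t : ℂ) * w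
        + (t : ℂ) * ((t : ℂ) * ((curlSq N R H / 2 + divSq N R H : ℝ) : ℂ)) := by
    rw [← bformV_self, bformV_add_left, bformV_add_right, bformV_smul_right, bformV_smul_left, Complex.conj_ofReal,
      bformV_add_right, bformV_smul_right, bformV_self, bformV_self, hfh, ← hw]
    ring
  have hre : (t : ℂ) * conj w + (t : ℂ) * w = ((2 * t * w.re : ℝ) : ℂ) := by
    rw [← mul_add, add_comm, Complex.add_conj]; push_cast; ring
  rw [add_assoc ((curlSq N R W / 2 + divSq N R W : ℝ) : ℂ), hre] at e
  have e' : ((curlSq N R (W + (t : ℂ) • H) / 2 + divSq N R (W + (t : ℂ) • H) : ℝ) : ℂ)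
      = (((curlSq N R W / 2 + divSq N R W) + 2 * t * w.re + t ^ 2 * (curlSq N R H / 2 + divSq N R H) : ℝ) : ℂ) := by
    rw [e]; push_cast; ring
  exact Complex.ofReal_injective e'

end General

/-! ## §2 First variation at a constrained minimiser of the Feynman inhabitant of the road's vector form -/

section Variation

variable (n : ℕ) [NeZero n] (M : Fin d → ℕ) [hM : ∀ μ, NeZero (M μ)]

omit [NeZero n] hM [InnerProductSpace ℂ E] [CompleteSpace E] in
/-- the line-indexed transported average is ℂ-LINEAR in the 1-form: `QvL T (W + c•H) = QvL T W + c•QvL T H`. [folklore] -/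
theorem QvL_add_smul [NormedSpace ℂ E] (T : Tor M → (Fin d → Fin n) → Fin n → Fin d → (E →L[ℂ] E)) (W H : Tor (fine n M) → Fin d → E)
    (c : ℂ) : QvL n M T (W + c • H) = QvL n M T W + c • QvL n M T H := by
  funext y μ
  simp only [QvL, Pi.add_apply, Pi.smul_apply, map_add, map_smul, sum_add_distrib, smul_add, Finset.smul_sum]
  congr 1
  exact sum_congr rfl fun j _ => sum_congr rfl fun t _ => smul_comm _ _ _

omit [NeZero n] hM [InnerProductSpace ℂ E] [CompleteSpace E] in
/-- `QvL T 0 = 0`. [folklore] -/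
theorem QvL_zero [NormedSpace ℂ E] (T : Tor M → (Fin d → Fin n) → Fin n → Fin d → (E →L[ℂ] E)) :
    QvL n M T (0 : Tor (fine n M) → Fin d → E) = 0 := by
  funext y μ
  simp [QvL]

/-- **THE FEYNMAN INHABITANT OF THE ROAD's VECTOR FORM**: `ScV n M R (landauG 1 R) W = n^{−d}·(n²·(curlSq W ∕ 2 + divSq W))`. [folklore] -/
theorem ScV_landau_one (R : Tor (fine n M) → Fin d → (E →L[ℂ] E)) (W : Tor (fine n M) → Fin d → E) :
    ScV n M R (landauG (fine n M) 1 R) W = ((n : ℝ) ^ d)⁻¹ * ((n : ℝ) ^ 2 * (curlSq (fine n M) R W / 2 + divSq (fine n M) R W)) := by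
  simp [ScV, landauG]

/-- minimising the Feynman inhabitant on a set is minimising the lattice Feynman action `F = curlSq∕2 + divSq` there. [folklore] -/
theorem feyn_le_of_ScV_le (R : Tor (fine n M) → Fin d → (E →L[ℂ] E)) {W W₂ : Tor (fine n M) → Fin d → E}
    (h : ScV n M R (landauG (fine n M) 1 R) W ≤ ScV n M R (landauG (fine n M) 1 R) W₂) :
    curlSq (fine n M) R W / 2 + divSq (fine n M) R W ≤ curlSq (fine n M) R W₂ / 2 + divSq (fine n M) R W₂ := by
  have hn : (0 : ℝ) < (n : ℝ) := by exact_mod_cast Nat.pos_of_ne_zero (NeZero.ne n)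
  rw [ScV_landau_one, ScV_landau_one] at h
  have h1 := le_of_mul_le_mul_left h (by positivity)
  exact le_of_mul_le_mul_left h1 (by positivity)

/-- **FIRST VARIATION**: if `W` minimises the Feynman inhabitant `ScV R (landauG 1 R)` on the affine fibre `{W₂ : QvL T W₂ = φ}` then the Feynman form
vanishes against the kernel: `bformV H W = 0` whenever `QvL T H = 0`. [folklore] -/
theorem bformV_eq_zero_of_isMin (T : Tor M → (Fin d → Fin n) → Fin n → Fin d → (E →L[ℂ] E)) (R : Tor (fine n M) → Fin d → (E →L[ℂ] E))
    {φ : Tor M → Fin d → E} {W : Tor (fine n M) → Fin d → E} (hW : QvL n M T W = φ)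
    (hmin : ∀ W₂, QvL n M T W₂ = φ → ScV n M R (landauG (fine n M) 1 R) W ≤ ScV n M R (landauG (fine n M) 1 R) W₂)
    {H : Tor (fine n M) → Fin d → E} (hH : QvL n M T H = 0) : bformV (fine n M) R H W = 0 := by
  have hre : ∀ H' : Tor (fine n M) → Fin d → E, QvL n M T H' = 0 → (bformV (fine n M) R H' W).re = 0 := by
    intro H' hH'
    set b : ℝ := (bformV (fine n M) R H' W).re
    set c : ℝ := curlSq (fine n M) R H' / 2 + divSq (fine n M) R H' with hc_def
    have hc : 0 ≤ c := by have := curlSq_nonneg (fine n M) R H'; have := divSq_nonneg (fine n M) R H'; positivity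
    have hq : ∀ t : ℝ, 0 ≤ 2 * t * b + t ^ 2 * c := fun t => by
      have hfib : QvL n M T (W + (t : ℂ) • H') = φ := by rw [QvL_add_smul, hH', smul_zero, add_zero, hW]
      have h1 := feyn_le_of_ScV_le n M R (hmin _ hfib)
      rw [feyn_add_smul] at h1
      rw [hc_def]
      linarith
    have hc1 : 0 < c + 1 := by linarith
    have h1 := hq (-b / (c + 1))
    have e : 2 * (-b / (c + 1)) * b + (-b / (c + 1)) ^ 2 * c = -(b ^ 2 * (c + 2)) / (c + 1) ^ 2 := by
      field_simp; ring
    rw [e] at h1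
    have h2 : b ^ 2 * (c + 2) ≤ 0 := by
      have := mul_nonneg h1 (le_of_lt (pow_pos hc1 2))
      rw [div_mul_cancel₀ _ (ne_of_gt (pow_pos hc1 2))] at this
      linarith
    nlinarith [sq_nonneg b]
  have h1 := hre H hH
  have h2 := hre (Complex.I • H) (by
    have := QvL_add_smul n M T 0 H Complex.I
    rw [zero_add, hH, smul_zero, add_zero, QvL_zero] at this
    exact this)
  rw [bformV_smul_left, Complex.conj_I] at h2
  have him : (bformV (fine n M) R H W).im = 0 := by
    have : (-Complex.I * bformV (fine n M) R H W).re = (bformV (fine n M) R H W).im := by simp [Complex.mul_re]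
    rw [← this]; exact h2
  exact Complex.ext h1 him

/-- **EULER–LAGRANGE, pairing form**: at a constrained minimiser, `Σ_ν ⟨H_ν, (elV W)_ν⟩_{ℓ²} = 0` for every `H ∈ ker QvL T`. [folklore] -/
theorem ipvV_elV_eq_zero_of_isMin (T : Tor M → (Fin d → Fin n) → Fin n → Fin d → (E →L[ℂ] E)) (R : Tor (fine n M) → Fin d → (E →L[ℂ] E))
    {φ : Tor M → Fin d → E} {W : Tor (fine n M) → Fin d → E} (hW : QvL n M T W = φ)
    (hmin : ∀ W₂, QvL n M T W₂ = φ → ScV n M R (landauG (fine n M) 1 R) W ≤ ScV n M R (landauG (fine n M) 1 R) W₂)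
    {H : Tor (fine n M) → Fin d → E} (hH : QvL n M T H = 0) : ipvV (fine n M) H (fun x ν => elV (fine n M) R W x ν) = 0 := by
  rw [ipvV_elV]
  exact bformV_eq_zero_of_isMin n M T R hW hmin hH

end Variation

end Summit.QuantumFields.BalabanUV.T4Continuum.VariationalVectorFeynmanForm

end
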